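import Summits.BirchSwinnertonDyer.Rank1Residual.X4.KuriharaLevelLoweringDescentDefect
import HarnessLib

/-!
# ADDITIVE level lowering kills Kurihara numbers: the TWO-PRIME theorem — a component-free decomposition `f = (α − α∘[ℓ₁]) + (β − β∘[ℓ₂])` whose Hecke derivatives form a `τ`-SYSTEM has vanishing Kurihara sums, modulo the surjectivity lemma S (cell `b2b-bsdres`, seat additive-p4 gen 30, line V51′; the SPREAD rows of CLASS-CLOSURE §3.1 N11)

HONEST FRAMING (verbatim, cell `b2b-bsdres`): the goal of the cell is to DELETE the COMBINATION-SHAPED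
residual classes for ALL analytic-rank `≤ 1` curves over `ℚ` — "full BSD formula for every rank `≤ 1`
curve in class `C`" assembled STRICTLY from published theorems — so that the rank-`≤ 1` remainder
becomes exactly the CONSTRUCTION-SHAPED classes, which are TYPED (missing-input Props), NOT attempted;
this is not "finishing BSD". This file: a research-route KERNEL THEOREM (pure algebra over an arbitrary
commutative ring; no named fact, no conjecture, nothing booked; X4 stays CONSTRUCTION-SHAPED).

## The mathematics (line V51′)

Gen 29/30 instruments: at two split Tamagawa primes `ℓ₁, ℓ₂` of `E` with `p`-exponents `e₁, e₂`, the
plus symbol satisfies `[·]⁺_f ≡ (α − α∘[ℓ₁]) + (β − β∘[ℓ₂]) (mod p^{e₁+e₂})` with `α`, `β` symbols of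
levels `N/ℓ₁`, `N/ℓ₂` (E8 FREE: the Pollack–Weston quantitative-level-lowering exponent is ADDITIVE), but
NEVER with `T_q`-eigen components beyond `max(e₁, e₂)` (E8 eigen). Writing `d_q = H_q − 2` (the Hecke
derivative at a Kolyvagin prime, `H_q` = `heckeTransform`), eigen-ness of the SUM forces
`(1−[ℓ₁]) d_U α = −(1−[ℓ₂]) d_U β` for every non-empty set `U` of Kolyvagin primes; when these common
elements come from level `N/(ℓ₁ℓ₂)` one gets a `τ`-SYSTEM: functions `τ_U` with
`d_U α = (1−[ℓ₂])τ_U`, `d_U β = −(1−[ℓ₁])τ_U`, `d_q τ_U = τ_{U∪q}` — a `1`-cocycle of the Hecke algebra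
which is NOT a coboundary (a coboundary `τ_U = d_U γ` would make `α − (1−[ℓ₂])γ` eigen). THEOREM (this
file, modulo lemma S): a `τ`-system forces `δ_n(f) = 0`. Proof: lemma S (surjectivity of
`γ ↦ (δ_m(d_U γ))_{(U,m)}` on ALL periodic functions, next file) supplies, for the given `n`, a `γ̃`
whose derivative Kurihara numbers below `n` equal those of `τ`; then `α' = α − (1−[ℓ₂])γ̃`,
`β' = β + (1−[ℓ₁])γ̃` still decompose `f` (the cross terms cancel) and the derivative Kurihara numbers of
`α'`, `β'` vanish by lemma V (`kuriharaSum_oldform_eq_zero_of_derivatives`, applied at the lower levels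
to `τ_U − d_U γ̃`), so lemma V applied to `α'` at `ℓ₁` and to `β'` at `ℓ₂` kills `δ_n(f)`.

## What is proved

* `heckeTransform_sub`, `heckeTransform_comp_natMul` (`H_q` commutes with `[c]` for `c` prime to `q` on
  periodic functions), `Phi_sub'`, `IsPeriodic.comp_natMul` — bookkeeping.
* **`kuriharaSum_twoPrime_eq_zero_of_tauSystem`** — data: derivative families `Dα`, `Dβ` (all `U`) and
  `τ` (non-empty `U`) over the primes of a predicate `P` (each prime to `ℓ₁ℓ₂`), the `τ`-system identities,
  a square-free `n` with `P`-prime factors prime to `ℓ₁ℓ₂`, and the lemma-S witness `G` (a derivative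
  family whose non-empty members have the same full Kurihara sums as `τ` at every admissible level);
  conclusion: the Kurihara sum at `n` of `f = (Dα ∅ − Dα ∅∘[ℓ₁]) + (Dβ ∅ − Dβ ∅∘[ℓ₂])` vanishes.

The lemma-S witness is an HYPOTHESIS here (`G`, `hG`, `hS`). It is DISCHARGED in gen 31: lemma S is
the theorem `exists_periodic_phi_derivFamily_eq` (`X4/KuriharaSurjectivityLemmaS.lean`, with
`X4/KuriharaDerivativeLeadingTerm.lean` and `X4/KuriharaBlockSolve.lean`) for additive characters `ψ_q`
taking the value `1` (e.g. surjective discrete logarithms), and `kuriharaSum_twoPrime_eq_zero`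
(`X4/KuriharaAdditiveLevelLoweringClosed.lean`) is this theorem with no auxiliary hypothesis; the
certificate predicate and the socket `∂^{(∞)} ≥ e₁ + e₂` are in `X4/KuriharaAdditiveCertificate.lean`.
Where the `τ`-system comes from on a row (not
asserted here): the seat's instrument E9 (`thcheck`: FREE decomposition mod `p^k`, the memberships
`d_q α ∈ (1−[ℓ₂])Z`, `d_q β ∈ −(1−[ℓ₁])Z` with a COMMON `τ_q` on Hecke generators, and the kernels of
`1−[ℓ_i]` mod `p`) — EVIDENCE per pair, never a Literature fact.

## References

* B. Mazur, J. Tate, J. Teitelbaum, Invent. Math. 84 (1986), §I.4 (4.2). [cite: MazurTateTeitelbaum1986Invent, §I.4 (4.2)]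
* M. Kurihara, Contrib. Math. Comput. Sci. 7 (2014) 317–356, §1.1 (1)–(2). [cite: Kurihara2014, §1.1]
* R. Pollack, T. Weston, Compos. Math. 147 (2011) 1353–1381 (quantitative level lowering). [cite: PollackWeston2011, Thm. 6.11 of arXiv:math/0610694 (quantitative level lowering, restated as Kim–Ota 2019 Thm. 1.2); provenance, not an input here (printed for p ≥ 5, p ∤ N square-free; the X4 rows are the ANALOGUE at p ∣ N)]
* C.-H. Kim, K. Ota, arXiv:1905.02926, Conj. 1.1, Thm. 1.3. [cite: KimOta2019CongruenceIdeals, Conj. 1.1 and Thm. 1.3 (text chunk p0003); provenance, not an input here (p ∤ N and N⁻ square-free there)]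
* B. Mazur, K. Rubin, Mem. AMS 799 (2004), Prop. 6.2.6 (prime-by-prime non-primitivity — the
  Galois-side shadow). [cite: MazurRubin2004, Prop. 6.2.6]
-/

noncomputable section

open scoped MatrixGroups ModularForm

open CongruenceSubgroup Finset

open Literature.NumberTheory.EllipticCurves Literature.NumberTheory.EllipticCurves.ModularForms

namespace Summit.BirchSwinnertonDyer.Rank1Residual.LevelLowering

variable {R : Type*} [CommRing R]

/-! ### §1 Bookkeeping: periodicity, linearity, and `H_q ∘ [c] = [c] ∘ H_q` -/

section Bookkeeping

variable {μ ν : ℚ → R}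

omit [CommRing R] in
/-- `r ↦ μ(c r)` is periodic when `μ` is (`c ∈ ℕ`). [folklore] -/
theorem IsPeriodic.comp_natMul (hμ : IsPeriodic μ) (c : ℕ) : IsPeriodic (fun r ↦ μ (c * r)) := by
  intro r z
  simp only
  exact hμ.eq_of_eq_add_int (c * z) (by push_cast; ring)

/-- Periodicity of a difference. [folklore] -/
theorem IsPeriodic.sub (hμ : IsPeriodic μ) (hν : IsPeriodic ν) : IsPeriodic (fun r ↦ μ r - ν r) :=
  fun r z ↦ by simp only [hμ r z, hν r z]

/-- Periodicity of a sum. [folklore] -/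
theorem IsPeriodic.add (hμ : IsPeriodic μ) (hν : IsPeriodic ν) : IsPeriodic (fun r ↦ μ r + ν r) :=
  fun r z ↦ by simp only [hμ r z, hν r z]

/-- The zero function is periodic. [folklore] -/
theorem isPeriodic_zero : IsPeriodic (fun _ : ℚ ↦ (0 : R)) := fun _ _ ↦ rfl

/-- `H_q` is additive: `H_q(μ − ν) = H_q μ − H_q ν`. [folklore] -/
theorem heckeTransform_sub (q : ℕ) (μ ν : ℚ → R) (r : ℚ) :
    heckeTransform q (fun x ↦ μ x - ν x) r = heckeTransform q μ r - heckeTransform q ν r := by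
  simp only [heckeTransform, Finset.sum_sub_distrib]
  ring

/-- `H_q(μ + ν) = H_q μ + H_q ν`. [folklore] -/
theorem heckeTransform_add (q : ℕ) (μ ν : ℚ → R) (r : ℚ) :
    heckeTransform q (fun x ↦ μ x + ν x) r = heckeTransform q μ r + heckeTransform q ν r := by
  simp only [heckeTransform, Finset.sum_add_distrib]
  ring

/-- `H_q 0 = 0`. [folklore] -/
theorem heckeTransform_zero (q : ℕ) (r : ℚ) : heckeTransform q (fun _ : ℚ ↦ (0 : R)) r = 0 := by
  simp [heckeTransform]

/-- **`H_q` commutes with `[c]` for `c` prime to `q`** on periodic functions: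
`H_q(μ∘[c])(r) = (H_q μ)(c r)` (the map `j ↦ c j` permutes `ℤ/q`, and `μ((cr + cj)/q) = μ((cr + (cj
mod q))/q)` by periodicity). [cite: MazurTateTeitelbaum1986Invent, §I.4 (4.2)] -/
theorem heckeTransform_comp_natMul (hμ : IsPeriodic μ) {q c : ℕ} (hq : q.Prime) (hc : c.Coprime q)
    (r : ℚ) : heckeTransform q (fun x ↦ μ (c * x)) r = heckeTransform q μ (c * r) := by
  have hq0 : 0 < q := hq.pos
  have hqQ : (q : ℚ) ≠ 0 := by exact_mod_cast hq.ne_zero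
  simp only [heckeTransform]
  have hlast : μ ((c : ℚ) * ((q : ℚ) * r)) = μ ((q : ℚ) * ((c : ℚ) * r)) := by ring_nf
  rw [hlast]
  congr 1
  -- the sums: reindex `j ↦ c j mod q`
  have hmaps : ∀ j ∈ Finset.range q, c * j % q ∈ Finset.range q :=
    fun j _ ↦ Finset.mem_range.mpr (Nat.mod_lt _ hq0)
  have hinj : Set.InjOn (fun j ↦ c * j % q) (Finset.range q : Set ℕ) := by
    intro j₁ hj₁ j₂ hj₂ h
    have hj₁' : j₁ < q := Finset.mem_range.mp (Finset.mem_coe.mp hj₁)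
    have hj₂' : j₂ < q := Finset.mem_range.mp (Finset.mem_coe.mp hj₂)
    have hmod : c * j₁ ≡ c * j₂ [MOD q] := h
    have hcancel : j₁ ≡ j₂ [MOD q] :=
      Nat.ModEq.cancel_left_of_coprime (by simpa [Nat.coprime_comm] using hc) hmod
    exact Nat.ModEq.eq_of_lt_of_lt hcancel hj₁' hj₂'
  have hsurj : Set.SurjOn (fun j ↦ c * j % q) (Finset.range q : Set ℕ) (Finset.range q : Set ℕ) :=
    Finset.surjOn_of_injOn_of_card_le _ hmaps hinj le_rfl
  refine Finset.sum_nbij (fun j ↦ c * j % q) hmaps hinj hsurj fun j _ ↦ ?_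
  -- `μ(c (r + j)/q) = μ((c r + (c j mod q))/q)`: they differ by the integer `c j / q`
  have hdecomp : ((c * j % q : ℕ) : ℚ) = (c : ℚ) * j - (q : ℚ) * ((c * j / q : ℕ) : ℚ) := by
    have h := Nat.mod_add_div (c * j) q
    have h' : ((c * j % q : ℕ) : ℚ) + (q : ℚ) * ((c * j / q : ℕ) : ℚ) = (c : ℚ) * j := by
      exact_mod_cast h
    linarith
  refine hμ.eq_of_eq_add_int ((c * j / q : ℕ) : ℤ) ?_
  rw [Int.cast_natCast, hdecomp]
  field_simp
  ring

/-- `Φ` is additive in the function: `Φ_T^{(m)}(μ − ν) = Φ_T^{(m)}(μ) − Φ_T^{(m)}(ν)`. [folklore] -/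
theorem Phi_sub' (ψ : (ℓ : ℕ) → (ZMod ℓ)ˣ →* Multiplicative R) (μ ν : ℚ → R) (m : ℕ) [NeZero m]
    (T : Finset ℕ) :
    Phi ψ (fun x ↦ μ x - ν x) m T = Phi ψ μ m T - Phi ψ ν m T := by
  simp only [Phi, lev, sub_mul, Finset.sum_sub_distrib]

/-- `Φ_T^{(m)}(0) = 0`. [folklore] -/
theorem Phi_zero' (ψ : (ℓ : ℕ) → (ZMod ℓ)ˣ →* Multiplicative R) (m : ℕ) [NeZero m] (T : Finset ℕ) :
    Phi ψ (fun _ : ℚ ↦ (0 : R)) m T = 0 := by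
  simp [Phi, lev]

end Bookkeeping

/-! ### §2 The two-prime theorem modulo lemma S -/

section TwoPrime

variable (ψ : (ℓ : ℕ) → (ZMod ℓ)ˣ →* Multiplicative R)

/-- A prime-to-`ℓ` level: if every prime factor of the square-free `m` is prime to `ℓ` then
`ℓ` is prime to `m`. [folklore] -/
private theorem coprime_of_primeFactors {ℓ m : ℕ} [NeZero m]
    (h : ∀ q ∈ m.primeFactors, q.Coprime ℓ) : ℓ.Coprime m :=
  Nat.Coprime.symm <| Nat.coprime_of_dvd fun k hk hkm hkℓ ↦ by
    have := h k (Nat.mem_primeFactors.mpr ⟨hk, hkm, NeZero.ne m⟩)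
    exact hk.one_lt.ne' (Nat.Coprime.eq_one_of_dvd this hkℓ)

/-- **ADDITIVE LEVEL LOWERING KILLS KURIHARA SUMS (two primes), modulo lemma S.** Data over the primes
of a predicate `P` (all prime, prime to `ℓ₁` and to `ℓ₂`): derivative families `Dα`, `Dβ` (`H_q (D U) =
2·D U + D(U ∪ {q})` for `q ∉ U`), a `τ`-SYSTEM `τ U` on the NON-EMPTY `P`-sets (`H_q τ_U = 2τ_U +
τ_{U∪q}`; `Dα U = τ_U − τ_U∘[ℓ₂]`, `Dβ U = −(τ_U − τ_U∘[ℓ₁])`), a square-free `n` with `P`-prime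
factors, and a LEMMA-S WITNESS `G` — a derivative family (all `U`) whose non-empty members have the same
full Kurihara sums as `τ` at every admissible level. Then the Kurihara sum at `n` of
`f = (Dα ∅ − Dα ∅∘[ℓ₁]) + (Dβ ∅ − Dβ ∅∘[ℓ₂])` vanishes:
`∑_{a ∈ (ℤ/n)ˣ} f(a/n) ∏_{q∣n} ψ_q(a) = 0`. [cite: Kurihara2014, §1.1 (1)–(2)]
[cite: MazurTateTeitelbaum1986Invent, §I.4 (4.2)] [cite: PollackWeston2011, Thm. 6.11 of arXiv:math/0610694 (quantitative level lowering, restated as Kim–Ota 2019 Thm. 1.2); provenance, not an input here (printed for p ≥ 5, p ∤ N square-free; the X4 rows are the ANALOGUE at p ∣ N)] -/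
theorem kuriharaSum_twoPrime_eq_zero_of_tauSystem {P : ℕ → Prop} {ℓ₁ ℓ₂ : ℕ}
    (hP : ∀ q, P q → q.Prime ∧ q.Coprime ℓ₁ ∧ q.Coprime ℓ₂)
    (Dα Dβ τ G : Finset ℕ → ℚ → R)
    (hperα : ∀ U, IsPeriodic (Dα U)) (hperβ : ∀ U, IsPeriodic (Dβ U))
    (hperτ : ∀ U, IsPeriodic (τ U)) (hperG : ∀ U, IsPeriodic (G U))
    (hDα : ∀ (U : Finset ℕ) (q : ℕ), P q → q ∉ U →
      ∀ r : ℚ, heckeTransform q (Dα U) r = 2 * Dα U r + Dα (insert q U) r)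
    (hDβ : ∀ (U : Finset ℕ) (q : ℕ), P q → q ∉ U →
      ∀ r : ℚ, heckeTransform q (Dβ U) r = 2 * Dβ U r + Dβ (insert q U) r)
    (hDG : ∀ (U : Finset ℕ) (q : ℕ), P q → q ∉ U →
      ∀ r : ℚ, heckeTransform q (G U) r = 2 * G U r + G (insert q U) r)
    (hDτ : ∀ (U : Finset ℕ), U.Nonempty → ∀ (q : ℕ), P q → q ∉ U →
      ∀ r : ℚ, heckeTransform q (τ U) r = 2 * τ U r + τ (insert q U) r)
    (h1 : ∀ U : Finset ℕ, U.Nonempty → (∀ q ∈ U, P q) → ∀ r : ℚ, Dα U r = τ U r - τ U (ℓ₂ * r))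
    (h2 : ∀ U : Finset ℕ, U.Nonempty → (∀ q ∈ U, P q) → ∀ r : ℚ, Dβ U r = -(τ U r - τ U (ℓ₁ * r)))
    (hS : ∀ (W : Finset ℕ), W.Nonempty → (∀ q ∈ W, P q) → ∀ (m : ℕ) [NeZero m], Squarefree m →
      (∀ q ∈ m.primeFactors, P q) → Disjoint W m.primeFactors →
      Phi ψ (G W) m m.primeFactors = Phi ψ (τ W) m m.primeFactors)
    (n : ℕ) [NeZero n] (hn : Squarefree n) (hPn : ∀ q ∈ n.primeFactors, P q) :
    ∑ a : (ZMod n)ˣ, ((Dα ∅ ((((a : ZMod n).val : ℕ) : ℚ) / n) -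
        Dα ∅ ((ℓ₁ : ℚ) * ((((a : ZMod n).val : ℕ) : ℚ) / n))) +
        (Dβ ∅ ((((a : ZMod n).val : ℕ) : ℚ) / n) -
        Dβ ∅ ((ℓ₂ : ℚ) * ((((a : ZMod n).val : ℕ) : ℚ) / n)))) *
        weight ψ n n.primeFactors a = 0 := by
  classical
  -- (0) restriction of a family to the `P`-sets (junk sets ↦ 0) keeps the derivative relation
  have hPins : ∀ (U : Finset ℕ) (q : ℕ), P q → ((∀ x ∈ insert q U, P x) ↔ ∀ x ∈ U, P x) := by
    intro U q hq
    simp only [Finset.forall_mem_insert, hq, true_and]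
  -- (1) the KEY vanishing at the lower levels: for `U` non-empty, the Kurihara sum of
  --     `(τ_U − G_U) − (τ_U − G_U)∘[ℓ]` vanishes (lemma V applied to `W ↦ τ(U∪W) − G(U∪W)`).
  have hkey : ∀ (ℓ : ℕ), (∀ q, P q → q.Coprime ℓ) → ∀ (U : Finset ℕ), U.Nonempty → (∀ q ∈ U, P q) →
      ∀ (m : ℕ) [NeZero m], Squarefree m → (∀ q ∈ m.primeFactors, P q) → Disjoint U m.primeFactors →
      ∑ a : (ZMod m)ˣ, ((τ U ((((a : ZMod m).val : ℕ) : ℚ) / m) - G U ((((a : ZMod m).val : ℕ) : ℚ) / m)) -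
        (τ U ((ℓ : ℚ) * ((((a : ZMod m).val : ℕ) : ℚ) / m)) -
          G U ((ℓ : ℚ) * ((((a : ZMod m).val : ℕ) : ℚ) / m)))) * weight ψ m m.primeFactors a = 0 := by
    intro ℓ hℓ U hU hUP m _ hm hPm hUm
    -- the family `E W = τ(U ∪ W) − G(U ∪ W)` on the `P`-sets disjoint from `U`, `0` elsewhere
    let Q : ℕ → Prop := fun q ↦ P q ∧ q ∉ U
    let E : Finset ℕ → ℚ → R := fun W ↦
      if (∀ x ∈ W, Q x) then (fun r ↦ τ (U ∪ W) r - G (U ∪ W) r) else fun _ ↦ 0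
    have hE_of : ∀ W : Finset ℕ, (∀ x ∈ W, Q x) → E W = fun r ↦ τ (U ∪ W) r - G (U ∪ W) r :=
      fun W hW ↦ if_pos hW
    have hE_not : ∀ W : Finset ℕ, ¬ (∀ x ∈ W, Q x) → E W = fun _ ↦ 0 := fun W hW ↦ if_neg hW
    have hperE : ∀ W, IsPeriodic (E W) := by
      intro W
      by_cases hW : ∀ x ∈ W, Q x
      · rw [hE_of W hW]; exact (hperτ _).sub (hperG _)
      · rw [hE_not W hW]; exact isPeriodic_zero
    have hDE : ∀ (W : Finset ℕ) (q : ℕ), Q q → q ∉ W →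
        ∀ r : ℚ, heckeTransform q (E W) r = 2 * E W r + E (insert q W) r := by
      intro W q hq hqW r
      by_cases hW : ∀ x ∈ W, Q x
      · have hW' : ∀ x ∈ insert q W, Q x := by
          simp only [Finset.forall_mem_insert]; exact ⟨hq, hW⟩
        rw [hE_of W hW, hE_of _ hW', heckeTransform_sub]
        have hqU : q ∉ U ∪ W := by
          rw [Finset.mem_union, not_or]; exact ⟨hq.2, hqW⟩
        have hUW : (U ∪ W).Nonempty := hU.mono Finset.subset_union_left
        simp only
        rw [hDτ (U ∪ W) hUW q hq.1 hqU r, hDG (U ∪ W) q hq.1 hqU r, Finset.union_insert]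
        ring
      · have hW' : ¬ ∀ x ∈ insert q W, Q x := fun h ↦ hW fun x hx ↦ h x (Finset.mem_insert_of_mem hx)
        rw [hE_not W hW, hE_not _ hW', heckeTransform_zero]
        simp
    have hvanE : ∀ (W : Finset ℕ), W.Nonempty → ∀ (m' : ℕ) [NeZero m'], Squarefree m' →
        (∀ q ∈ m'.primeFactors, Q q) → Disjoint W m'.primeFactors →
        Phi ψ (E W) m' m'.primeFactors = 0 := by
      intro W hW m' _ hm' hQm' hWm'
      by_cases hWQ : ∀ x ∈ W, Q x
      · rw [hE_of W hWQ, Phi_sub', sub_eq_zero]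
        have hUW : (U ∪ W).Nonempty := hU.mono Finset.subset_union_left
        have hUWP : ∀ q ∈ U ∪ W, P q := by
          intro q hq
          rcases Finset.mem_union.mp hq with h | h
          exacts [hUP q h, (hWQ q h).1]
        have hdisj : Disjoint (U ∪ W) m'.primeFactors := by
          rw [Finset.disjoint_union_left]
          refine ⟨Finset.disjoint_left.mpr fun x hxU hxm ↦ (hQm' x hxm).2 hxU, hWm'⟩
        exact (hS (U ∪ W) hUW hUWP m' hm' (fun q hq ↦ (hQm' q hq).1) hdisj).symm
      · rw [hE_not W hWQ, Phi_zero']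
    have hQm : ∀ q ∈ m.primeFactors, Q q :=
      fun q hq ↦ ⟨hPm q hq, fun hqU ↦ Finset.disjoint_left.mp hUm hqU hq⟩
    have hℓm : ℓ.Coprime m := coprime_of_primeFactors fun q hq ↦ hℓ q (hPm q hq)
    have h := kuriharaSum_oldform_eq_zero_of_derivatives ψ E hperE hDE hvanE m hm hQm hℓm
    have hE0 : E ∅ = fun r ↦ τ U r - G U r := by
      rw [hE_of ∅ (by simp), Finset.union_empty]
    rw [hE0] at h
    exact h
  -- (2) the corrected families `α' = Dα − (G − G∘[ℓ₂])`, `β' = Dβ + (G − G∘[ℓ₁])` on the `P`-sets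
  let A : Finset ℕ → ℚ → R := fun U ↦
    if (∀ x ∈ U, P x) then (fun r ↦ Dα U r - (G U r - G U (ℓ₂ * r))) else fun _ ↦ 0
  let B : Finset ℕ → ℚ → R := fun U ↦
    if (∀ x ∈ U, P x) then (fun r ↦ Dβ U r + (G U r - G U (ℓ₁ * r))) else fun _ ↦ 0
  have hA_of : ∀ U : Finset ℕ, (∀ x ∈ U, P x) → A U = fun r ↦ Dα U r - (G U r - G U (ℓ₂ * r)) :=
    fun U hU ↦ if_pos hU
  have hA_not : ∀ U : Finset ℕ, ¬ (∀ x ∈ U, P x) → A U = fun _ ↦ 0 := fun U hU ↦ if_neg hU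
  have hB_of : ∀ U : Finset ℕ, (∀ x ∈ U, P x) → B U = fun r ↦ Dβ U r + (G U r - G U (ℓ₁ * r)) :=
    fun U hU ↦ if_pos hU
  have hB_not : ∀ U : Finset ℕ, ¬ (∀ x ∈ U, P x) → B U = fun _ ↦ 0 := fun U hU ↦ if_neg hU
  have hperA : ∀ U, IsPeriodic (A U) := by
    intro U
    by_cases hU : ∀ x ∈ U, P x
    · rw [hA_of U hU]; exact (hperα U).sub ((hperG U).sub ((hperG U).comp_natMul ℓ₂))
    · rw [hA_not U hU]; exact isPeriodic_zero
  have hperB : ∀ U, IsPeriodic (B U) := by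
    intro U
    by_cases hU : ∀ x ∈ U, P x
    · rw [hB_of U hU]; exact (hperβ U).add ((hperG U).sub ((hperG U).comp_natMul ℓ₁))
    · rw [hB_not U hU]; exact isPeriodic_zero
  -- derivative relations for `A`, `B` (the Hecke transform commutes with `[ℓ_i]`)
  have hDA : ∀ (U : Finset ℕ) (q : ℕ), P q → q ∉ U →
      ∀ r : ℚ, heckeTransform q (A U) r = 2 * A U r + A (insert q U) r := by
    intro U q hq hqU r
    by_cases hU : ∀ x ∈ U, P x
    · have hU' : ∀ x ∈ insert q U, P x := (hPins U q hq).mpr hU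
      rw [hA_of U hU, hA_of _ hU', heckeTransform_sub, heckeTransform_sub,
        heckeTransform_comp_natMul (hperG U) (hP q hq).1 ((hP q hq).2.2.symm) r]
      simp only
      rw [hDα U q hq hqU r, hDG U q hq hqU r, hDG U q hq hqU (ℓ₂ * r)]
      ring
    · have hU' : ¬ ∀ x ∈ insert q U, P x := fun h ↦ hU ((hPins U q hq).mp h)
      rw [hA_not U hU, hA_not _ hU', heckeTransform_zero]
      simp
  have hDB : ∀ (U : Finset ℕ) (q : ℕ), P q → q ∉ U →
      ∀ r : ℚ, heckeTransform q (B U) r = 2 * B U r + B (insert q U) r := by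
    intro U q hq hqU r
    by_cases hU : ∀ x ∈ U, P x
    · have hU' : ∀ x ∈ insert q U, P x := (hPins U q hq).mpr hU
      rw [hB_of U hU, hB_of _ hU', heckeTransform_add, heckeTransform_sub,
        heckeTransform_comp_natMul (hperG U) (hP q hq).1 ((hP q hq).2.1.symm) r]
      simp only
      rw [hDβ U q hq hqU r, hDG U q hq hqU r, hDG U q hq hqU (ℓ₁ * r)]
      ring
    · have hU' : ¬ ∀ x ∈ insert q U, P x := fun h ↦ hU ((hPins U q hq).mp h)
      rw [hB_not U hU, hB_not _ hU', heckeTransform_zero]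
      simp
  -- the derivative Kurihara numbers of `A`, `B` vanish (step (1))
  have hvanA : ∀ (U : Finset ℕ), U.Nonempty → ∀ (m : ℕ) [NeZero m], Squarefree m →
      (∀ q ∈ m.primeFactors, P q) → Disjoint U m.primeFactors → Phi ψ (A U) m m.primeFactors = 0 := by
    intro U hU m _ hm hPm hUm
    by_cases hUP : ∀ x ∈ U, P x
    · rw [hA_of U hUP]
      have h := hkey ℓ₂ (fun q hq ↦ (hP q hq).2.2) U hU hUP m hm hPm hUm
      unfold Phi lev
      refine Eq.trans (Finset.sum_congr rfl fun a _ ↦ ?_) h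
      simp only [h1 U hU hUP]
      ring
    · rw [hA_not U hUP, Phi_zero']
  have hvanB : ∀ (U : Finset ℕ), U.Nonempty → ∀ (m : ℕ) [NeZero m], Squarefree m →
      (∀ q ∈ m.primeFactors, P q) → Disjoint U m.primeFactors → Phi ψ (B U) m m.primeFactors = 0 := by
    intro U hU m _ hm hPm hUm
    by_cases hUP : ∀ x ∈ U, P x
    · rw [hB_of U hUP]
      have h := hkey ℓ₁ (fun q hq ↦ (hP q hq).2.1) U hU hUP m hm hPm hUm
      have h' : ∑ a : (ZMod m)ˣ, -(((τ U ((((a : ZMod m).val : ℕ) : ℚ) / m) -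
          G U ((((a : ZMod m).val : ℕ) : ℚ) / m)) -
          (τ U ((ℓ₁ : ℚ) * ((((a : ZMod m).val : ℕ) : ℚ) / m)) -
            G U ((ℓ₁ : ℚ) * ((((a : ZMod m).val : ℕ) : ℚ) / m)))) * weight ψ m m.primeFactors a) = 0 := by
        rw [Finset.sum_neg_distrib, h, neg_zero]
      unfold Phi lev
      refine Eq.trans (Finset.sum_congr rfl fun a _ ↦ ?_) h'
      simp only [h2 U hU hUP]
      ring
    · rw [hB_not U hUP, Phi_zero']
  -- (3) lemma V at level `n` for `A` (prime `ℓ₁`) and for `B` (prime `ℓ₂`)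
  have hℓ₁n : ℓ₁.Coprime n := coprime_of_primeFactors fun q hq ↦ (hP q (hPn q hq)).2.1
  have hℓ₂n : ℓ₂.Coprime n := coprime_of_primeFactors fun q hq ↦ (hP q (hPn q hq)).2.2
  have hAn := kuriharaSum_oldform_eq_zero_of_derivatives ψ A hperA hDA hvanA n hn hPn hℓ₁n
  have hBn := kuriharaSum_oldform_eq_zero_of_derivatives ψ B hperB hDB hvanB n hn hPn hℓ₂n
  have hA0 : A ∅ = fun r ↦ Dα ∅ r - (G ∅ r - G ∅ (ℓ₂ * r)) := hA_of ∅ (by simp)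
  have hB0 : B ∅ = fun r ↦ Dβ ∅ r + (G ∅ r - G ∅ (ℓ₁ * r)) := hB_of ∅ (by simp)
  rw [hA0] at hAn
  rw [hB0] at hBn
  -- (4) `f = (A ∅ − A ∅∘[ℓ₁]) + (B ∅ − B ∅∘[ℓ₂])` pointwise (the `G`-cross terms cancel), then add
  have hsum := congrArg₂ (· + ·) hAn hBn
  simp only [add_zero] at hsum
  rw [← Finset.sum_add_distrib] at hsum
  refine Eq.trans (Finset.sum_congr rfl fun a _ ↦ ?_) hsum
  have hcomm : (ℓ₂ : ℚ) * ((ℓ₁ : ℚ) * ((((a : ZMod n).val : ℕ) : ℚ) / n)) =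
      (ℓ₁ : ℚ) * ((ℓ₂ : ℚ) * ((((a : ZMod n).val : ℕ) : ℚ) / n)) := by ring
  simp only [hcomm]
  ring

end TwoPrime

end Summit.BirchSwinnertonDyer.Rank1Residual.LevelLowering

end
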